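import Literature.MathematicalPhysics.QuantumFieldTheory.Balaban1983to89.B4GaugeCovariance

/-!
# [B4] §2, (2.3), (2.5), (2.8)–(2.11): the commutators `[H_k(Ã), h]` behind `K_j`, and the parametrix identity

Audit cell `pub-balaban`, paper sub-cell B04 — a kernel certificate for the ALGEBRA of the first step of §2 of
[Balaban1983RegularityDecay] (T. Bałaban, *Regularity and decay of lattice Green's functions*, Commun. Math. Phys.
89 (1983) 571–597), pp. 575–577, in the typing of `B4GaugeCovariance` (block operators on `ℝ^ι`-valued lattice
functions over an ARBITRARY finite site set `X`, bond weights `c`, link variables `W`, block weights `q`,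
transporters `T`; the operator (1.6) is `covOp c m2 a q W T = −Δ_W + m² + a·Q^*Q`).

## Text under audit (verbatim, [B4] pp. 575–577)

* (2.3) «(D^η_A hφ)(b) = h(b₊)(D^η_Aφ)(b) + (∂^ηh)(b)φ(b₋), where h is a real valued function».
* (2.5) «(−Δ^{η,N}_{A,Ω}hφ)(x) = (−Δ^{η,N}_Ω h)(x)φ(x) − Σ_{b∈st(x), b⊂Ω} (∂^ηh)(b)(D^η_Aφ)(b) + h(x)(−Δ^{η,N}_{A,Ω}φ)(x).
  Special care has to be taken in considering boundary terms.»
* (2.8) «(P_k(A)hφ)(x) = h(x)(P_k(A)φ)(x) + Σ_{x'∈B^k(y^k(x))} η^d U(A(Γ^{(k)}_{x,y^k(x),x'}))(∂^ηh)(Γ^{(k)}_{x,y^k(x),x'})φ(x')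
  =: h(x)(P_k(A)φ)(x) + (R_k(A,∂^ηh)φ)(x).»
* (2.9), second line: «= δ^η(x−x') − Σ_j [Σ_{b∈st(x)}(∂^ηh_j)(b)(D^η_{Ã_j}G_k(□_j,Ã_j))(b,x')h_j(x') +
  (Δ^ηh_j)(x)G_k(□_j,Ã_j;x,x')h_j(x') − (R_k(Ã_j,∂^ηh_j)G_k(□_j,Ã_j))(x,x')h_j(x')].»
* (2.10)–(2.11) «Let us define the operators
  (2.10) (K_jφ)(x) = □_j(x)[Σ_{b∈st(x)}(∂^ηh_j)(b)(D^η_{Ã_j}φ)(b) + (Δ^ηh_j)(x)φ(x) − Σ_{x'∈B^k(y^k(x))}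
  η^d(∂^ηh_j)(Γ^{(k)}_{x,y^k(x),x'})U(Ã_j(Γ^{(k)}_{x,y^k(x),x'}))φ(x')],
  (2.11) R = Σ_j K_j G_k(□_j,Ã_j)h_j.»  and p. 577 «so we have the representations
  (2.12) G_k(Ω,A) = G₀(I − R)^{−1} = Σ_{n=0}^∞ G₀R^n.»

## Dictionary (generic ↦ [B4])

* `mulH h` = the block-diagonal operator `φ ↦ hφ` of multiplication by a real site function `h` ([B4]'s `h`, `h_j`,
  the indicator `□_j`); `bondDiff W x y` ↦ the covariant bond difference `W(b)φ(b₊) − φ(b₋)` of the bond `b = ⟨x,y⟩`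
  (`= η(D^η_Aφ)(b)`); `covLap c W` ↦ `−Δ^{η,N}_{A,Ω}` with [B4]'s weights `c(x,y) = η^{-2}/2` on both orientations of
  each nearest-neighbour bond inside `Ω` (`B4GaugeCovariance.boxWt`; Neumann: no bonds leave `Ω`), so that
  `2c(x,y)(h(y) − h(x)) = η^{-1}(∂^ηh)(⟨x,y⟩)`, `2Σ_y c(x,y)(h(y) − h(x)) = (Δ^{η,N}_Ω h)(x)` and
  `2c(x,y)(h(y) − h(x))·(W(x,y)φ(y) − φ(x)) = (∂^ηh)(b)(D^η_Aφ)(b)`, `b = ⟨x,y⟩`; `projOp q T = Q^*Q` ↦ `P_k(A)` with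
  `Σ_y q(y,x)q(y,x')T(y,x)ᵀT(y,x')` ↦ `η^d·1[x, x' ∈ B^k(y)]·U(A(Γ^{(k)}_{x,y,x'}))` (the `η`-powers of (1.4)–(1.5) sit
  in `q` and `a`, as everywhere in the lineage), and `h(x') − h(x)` ↦ «(∂^ηh)(Γ^{(k)}_{x,y^k(x),x'})» (the sum of
  `η∂^ηh` along the contour telescopes to the difference of the end values);
* `opK c m2 a q W T h := mulH h * H − H * mulH h`, `H = covOp c m2 a q W T` ↦ `K_j` of (2.10) for `h = h_j`,
  `H = H_k(□_j,Ã_j)` (the indicator `□_j(x)` is automatic: our `X` is the site set of `□_j`);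
* §5: an index set `J` of cubes, site functions `h j`, "local" operators `Hj j` with inverses `G j`
  (`Hj j * G j = 1` ↦ `G_k(□_j,Ã_j) = H_k(□_j,Ã_j)^{-1}`), a "global" `H` ↦ `H_k(Ω,A)`, the LOCALITY hypothesis
  `H * mulH (h j) = Hj j * mulH (h j)` ↦ (2.6) («because the function h_j can be ≠ 0 only on the part of the
  boundary of □_j which is contained in the boundary of Ω» and `Ã_j = A` on `supp h_j`), and `Σ_j h_j² = 1`.

## What this module proves (every `theorem` in full; generic finite `X`, `Y`, `ι`, any `c`, `W`, `q`, `T`)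

* §1 `mulH` and the COMMUTATOR KERNEL: for every block operator `B` with kernel `K`,
  `[mulH h, B] = mulH h * B − B * mulH h` is the block operator with kernel `(h(z) − h(z'))K(z,z')`
  (`mulH_comm_blockOp`), sitewise `Σ_{z'} (h(z) − h(z'))K(z,z')φ(z')` (`fld_comm_mulVec`); `Σ_j mulH(h_j)² =
  mulH(Σ_j h_j²)` (`sum_mulH_mul_mulH`).
* §2 (2.3) `fld_bondDiff_mulH` and (2.5) `fld_covLap_mulH` — the printed Leibniz rules, (2.5) under the two
  structural facts of [B4]'s weights/links: `c` symmetric and `W(y,x) = W(x,y)ᵀ` on the support of `c` (true for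
  `U(ηA_b)` with `A_{−b} = −A_b`, «We assume also that A_{−b} = −A_b for an arbitrary bond b»); the commutator
  `[mulH h, −Δ_W]` as a block operator (`covLap_comm`).
* §3 (2.8) `fld_projOp_mulH` (no hypothesis) and `projOp_comm`.
* §4 (2.10): `opK` is `[mulH h, −Δ_W] + a[mulH h, Q^*Q]` (`opK_eq`, the mass term commutes), with block kernel
  `(h(z) − h(z'))(covLapKer + a·P-kernel)(z,z')` (`opK_eq_blockOp`) and the printed sitewise formula
  `(Kφ)(x) = Σ_b (∂^ηh)(b)(D^η_Aφ)(b) + (Δ^ηh)(x)φ(x) − a·Σ_{x'}(h(x') − h(x))P(x,x')φ(x')` (`fld_opK_mulVec`).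
* §5 (2.9) ⇒ (2.11): the PARAMETRIX IDENTITY `H·G₀ = 1 − R`, `G₀ = Σ_j mulH(h_j) G_j mulH(h_j)`,
  `R = Σ_j K_j G_j mulH(h_j)`, `K_j = mulH(h_j)H_j − H_j mulH(h_j)`, from locality, `H_jG_j = 1` and `Σ_j h_j² = 1`
  (`parametrix_identity`); hence `H·G₀·S = 1` for any `S` with `(1 − R)S = 1`, i.e. the algebra of
  (2.12) `G_k(Ω,A) = G₀(I − R)^{−1}` given a (right) inverse of `H` (`green_eq_G0_mul_of_inv`).

## What it does NOT prove

Nothing analytic: no bound on `K_j` (the sizes «|∂^ηh_j| ≤ O(M^{−1}), |Δ^ηh_j| ≤ O(M^{−2})» and the estimates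
`‖K_jG_k(□_j,Ã_j)h_j‖ ≤ c₂O(1)M^{−1}` via Lemma 2.2 are the next node), no convergence of (2.12), no construction
of the partition of unity `h_j` or of `Ã_j`, and the locality (2.6) is a HYPOTHESIS of §5 (its verification for
[B4]'s `□_j ⊂ Ω` with Neumann weights is lattice geometry not done here); the random-walk form (2.13) of the
series is `B4RandomWalk213`, the exponent chain (2.18)–(2.22) is `B4LpChain221`.  (2.4) (the adjoint rule) is
not typed.  Value = kernel certificate that the displayed formulas (2.3), (2.5), (2.8), (2.10) ARE the commutator
of [B4]'s operator (1.6) with a multiplication operator, and that (2.9)–(2.11) follow by pure algebra; NOT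
progress on any summit statement.
-/

namespace Literature.MathematicalPhysics.QuantumFieldTheory.Balaban1983to89.B4Commutators25to211

open Finset
open scoped Matrix
open Literature.MathematicalPhysics.QuantumFieldTheory.Balaban1983to89.B4GaugeCovariance

variable {X Y ι : Type*}

/-! ## §1 Multiplication operators and the commutator kernel -/

section MulH

variable [Fintype X] [Fintype ι] [DecidableEq X] [DecidableEq ι]

/-- MULTIPLICATION BY A REAL SITE FUNCTION `h` on `ℝ^ι`-valued lattice functions: the block-diagonal operator with
blocks `h(x)·1` ([B4]'s `φ ↦ hφ`, `φ ↦ h_jφ`). [cite: Balaban1983RegularityDecay, (2.2)–(2.5) pp. 575–576] -/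
def mulH (h : X → ℝ) : Matrix (X × ι) (X × ι) ℝ :=
  blockDiag fun x => h x • (1 : Matrix ι ι ℝ)

/-- `(hΦ)(x) = h(x)φ(x)`. [folklore] -/
theorem fld_mulH_mulVec (h : X → ℝ) (Φ : X × ι → ℝ) (x : X) :
    fld (mulH (ι := ι) h *ᵥ Φ) x = h x • fld Φ x := by
  rw [mulH, fld_blockDiag_mulVec, Matrix.smul_mulVec, Matrix.one_mulVec]

/-- right multiplication of a block operator by `mulH h` multiplies the kernel column `z'` by `h(z')`. [folklore] -/
theorem blockOp_mul_mulH (K : X → X → Matrix ι ι ℝ) (h : X → ℝ) :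
    blockOp K * mulH (ι := ι) h = blockOp fun z z' => h z' • K z z' := by
  rw [mulH, blockOp_mul_blockDiag]
  congr 1
  funext z z'
  rw [Matrix.mul_smul, Matrix.mul_one]

/-- left multiplication of a block operator by `mulH h` multiplies the kernel row `z` by `h(z)`. [folklore] -/
theorem mulH_mul_blockOp (K : X → X → Matrix ι ι ℝ) (h : X → ℝ) :
    mulH (ι := ι) h * blockOp K = blockOp fun z z' => h z • K z z' := by
  rw [mulH, blockDiag_mul_blockOp]
  congr 1
  funext z z'
  rw [Matrix.smul_mul, Matrix.one_mul]

/-- **THE COMMUTATOR KERNEL**: `[h, B](z,z') = (h(z) − h(z'))B(z,z')` for every block operator `B`; in particular the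
diagonal of the kernel drops out (the mechanism of (2.5), (2.8), (2.10)). [folklore] -/
theorem mulH_comm_blockOp (K : X → X → Matrix ι ι ℝ) (h : X → ℝ) :
    mulH (ι := ι) h * blockOp K - blockOp K * mulH (ι := ι) h = blockOp fun z z' => (h z - h z') • K z z' := by
  rw [mulH_mul_blockOp, blockOp_mul_mulH, ← blockOp_sub]
  congr 1
  funext z z'
  simp only [Pi.sub_apply, sub_smul]

/-- the commutator sitewise: `([h, B]Φ)(z) = Σ_{z'} (h(z) − h(z'))B(z,z')φ(z')`. [folklore] -/
theorem fld_comm_mulVec (K : X → X → Matrix ι ι ℝ) (h : X → ℝ) (Φ : X × ι → ℝ) (z : X) :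
    fld ((mulH (ι := ι) h * blockOp K - blockOp K * mulH (ι := ι) h) *ᵥ Φ) z
      = ∑ z', (h z - h z') • (K z z' *ᵥ fld Φ z') := by
  rw [mulH_comm_blockOp, fld_blockOp_mulVec]
  refine Finset.sum_congr rfl fun z' _ => ?_
  rw [Matrix.smul_mulVec]

omit [Fintype X] [Fintype ι] in
/-- `mulH` is additive. [folklore] -/
theorem mulH_add (h h' : X → ℝ) : mulH (ι := ι) (h + h') = mulH (ι := ι) h + mulH (ι := ι) h' := by
  unfold mulH B4GaugeCovariance.blockDiag
  rw [← blockOp_add]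
  congr 1
  funext x y
  by_cases hxy : x = y
  · simp [hxy, add_smul]
  · simp [hxy]

omit [Fintype X] [Fintype ι] in
/-- `mulH 0 = 0`. [folklore] -/
theorem mulH_zero : mulH (ι := ι) (0 : X → ℝ) = 0 := by
  unfold mulH B4GaugeCovariance.blockDiag
  rw [← blockOp_zero]
  congr 1
  funext x y
  by_cases hxy : x = y
  · simp [hxy]
  · simp [hxy]

omit [Fintype X] [Fintype ι] in
/-- `mulH 1 = 1`. [folklore] -/
theorem mulH_one : mulH (ι := ι) (fun _ : X => (1 : ℝ)) = 1 := by
  unfold mulH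
  simp only [one_smul]
  exact blockDiag_one

/-- `mulH h · mulH h' = mulH (hh')`. [folklore] -/
theorem mulH_mul_mulH (h h' : X → ℝ) :
    mulH (ι := ι) h * mulH (ι := ι) h' = mulH (ι := ι) fun x => h x * h' x := by
  unfold mulH
  rw [blockDiag_mul_blockDiag]
  congr 1
  funext x
  rw [Matrix.smul_mul, Matrix.one_mul, smul_smul]

omit [Fintype X] [Fintype ι] in
/-- `mulH` of a finite sum. [folklore] -/
theorem mulH_sum {J : Type*} (s : Finset J) (h : J → X → ℝ) :
    mulH (ι := ι) (fun x => ∑ j ∈ s, h j x) = ∑ j ∈ s, mulH (ι := ι) (h j) := by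
  classical
  induction s using Finset.induction_on with
  | empty =>
    simp only [Finset.sum_empty]
    exact mulH_zero
  | insert j s hj ih =>
    rw [Finset.sum_insert hj, ← ih, ← mulH_add]
    congr 1
    funext x
    rw [Finset.sum_insert hj]
    rfl

/-- `Σ_j mulH(h_j)² = mulH(Σ_j h_j²)` — so [B4]'s «Σ_{j∈Z} h_j² = 1» makes `Σ_j mulH(h_j)²` the identity.
[cite: Balaban1983RegularityDecay, p. 575] -/
theorem sum_mulH_mul_mulH {J : Type*} (s : Finset J) (h : J → X → ℝ) :
    ∑ j ∈ s, mulH (ι := ι) (h j) * mulH (ι := ι) (h j) = mulH (ι := ι) fun x => ∑ j ∈ s, h j x ^ 2 := by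
  rw [mulH_sum]
  refine Finset.sum_congr rfl fun j _ => ?_
  rw [mulH_mul_mulH]
  congr 1
  funext x
  rw [sq]

/-- the partition-of-unity identity: `Σ_j h_j(x)² = 1` for all `x` ⇒ `Σ_j mulH(h_j)·mulH(h_j) = 1`.
[cite: Balaban1983RegularityDecay, p. 575] -/
theorem sum_mulH_sq_eq_one {J : Type*} (s : Finset J) (h : J → X → ℝ) (hsum : ∀ x, ∑ j ∈ s, h j x ^ 2 = 1) :
    ∑ j ∈ s, mulH (ι := ι) (h j) * mulH (ι := ι) (h j) = 1 := by
  rw [sum_mulH_mul_mulH, ← mulH_one]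
  congr 1
  funext x
  exact hsum x

end MulH

/-! ## §2 (2.3) and (2.5): the Leibniz rules for the covariant bond difference and the covariant Laplacian -/

section Laplacian

variable [Fintype X] [Fintype ι] [DecidableEq X] [DecidableEq ι]

/-- **(2.3) AS PRINTED** («(D^η_A hφ)(b) = h(b₊)(D^η_Aφ)(b) + (∂^ηh)(b)φ(b₋), where h is a real valued function»), for
the covariant bond difference of `b = ⟨x,y⟩` (`b₋ = x`, `b₊ = y`; multiply by `η^{-1}` for `D^η`):
`W(hφ)(y) − (hφ)(x) = h(y)(Wφ(y) − φ(x)) + (h(y) − h(x))φ(x)`. [cite: Balaban1983RegularityDecay, (2.3) p. 575] -/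
theorem fld_bondDiff_mulH (W : X → X → Matrix ι ι ℝ) (h : X → ℝ) (x y : X) (Φ : X × ι → ℝ) (u : Unit) :
    fld (bondDiff W x y *ᵥ (mulH (ι := ι) h *ᵥ Φ)) u
      = h y • fld (bondDiff W x y *ᵥ Φ) u + (h y - h x) • fld Φ x := by
  rw [fld_bondDiff_mulVec, fld_bondDiff_mulVec, fld_mulH_mulVec, fld_mulH_mulVec, Matrix.mulVec_smul, smul_sub,
    sub_smul]
  abel

/-- the commutator `[h, −Δ_W]` is the block operator with kernel `(h(z) − h(z'))(−Δ_W)(z,z')`.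
[cite: Balaban1983RegularityDecay, (2.5) p. 576] -/
theorem covLap_comm (c : X → X → ℝ) (W : X → X → Matrix ι ι ℝ) (h : X → ℝ) :
    mulH (ι := ι) h * covLap c W - covLap c W * mulH (ι := ι) h
      = blockOp fun z z' => (h z - h z') • covLapKer c W z z' := by
  rw [covLap_eq_blockOp, mulH_comm_blockOp]

/-- the off-diagonal kernel of `−Δ_W` weighted by `h(z) − h(z')`: the diagonal blocks of `covLapKer` drop out and
`(h(z) − h(z'))(−Δ_W)(z,z') = −(h(z) − h(z'))(c(z',z)W(z',z)ᵀ + c(z,z')W(z,z'))`. [folklore] -/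
theorem sub_smul_covLapKer (c : X → X → ℝ) (W : X → X → Matrix ι ι ℝ) (h : X → ℝ) (z z' : X) :
    (h z - h z') • covLapKer c W z z' = -((h z - h z') • (c z' z • (W z' z)ᵀ + c z z' • W z z')) := by
  by_cases hz : z = z'
  · subst hz
    simp
  · rw [covLapKer, if_neg hz, if_neg hz, zero_sub, sub_zero, smul_sub, smul_neg, smul_add]
    abel

/-- `−Δ_W(hΦ) = h(−Δ_WΦ) + Σ_{z'}(h(z) − h(z'))(c(z',z)W(z',z)ᵀ + c(z,z')W(z,z'))φ(z')` — (2.5) with no hypothesis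
on the weights. [cite: Balaban1983RegularityDecay, (2.5) p. 576] -/
theorem fld_covLap_mulH_gen (c : X → X → ℝ) (W : X → X → Matrix ι ι ℝ) (h : X → ℝ) (Φ : X × ι → ℝ) (z : X) :
    fld (covLap c W *ᵥ (mulH (ι := ι) h *ᵥ Φ)) z
      = h z • fld (covLap c W *ᵥ Φ) z
        + ∑ z', (h z - h z') • ((c z' z • (W z' z)ᵀ + c z z' • W z z') *ᵥ fld Φ z') := by
  have hcomm : covLap c W * mulH (ι := ι) h
      = mulH (ι := ι) h * covLap c W - blockOp fun z z' => (h z - h z') • covLapKer c W z z' := by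
    rw [← covLap_comm]; abel
  rw [Matrix.mulVec_mulVec, hcomm, Matrix.sub_mulVec, ← Matrix.mulVec_mulVec]
  have h1 : fld ((mulH (ι := ι) h *ᵥ (covLap c W *ᵥ Φ))
        - (blockOp fun z z' => (h z - h z') • covLapKer c W z z') *ᵥ Φ) z
      = fld (mulH (ι := ι) h *ᵥ (covLap c W *ᵥ Φ)) z
        - fld ((blockOp fun z z' => (h z - h z') • covLapKer c W z z') *ᵥ Φ) z := by
    funext i; rfl
  rw [h1, fld_mulH_mulVec, fld_blockOp_mulVec, sub_eq_add_neg, ← Finset.sum_neg_distrib]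
  congr 1
  refine Finset.sum_congr rfl fun z' _ => ?_
  rw [sub_smul_covLapKer, Matrix.neg_mulVec, neg_neg, Matrix.smul_mulVec]

/-- **(2.5) AS PRINTED** («(−Δ^{η,N}_{A,Ω}hφ)(x) = (−Δ^{η,N}_Ω h)(x)φ(x) − Σ_{b∈st(x), b⊂Ω} (∂^ηh)(b)(D^η_Aφ)(b) +
h(x)(−Δ^{η,N}_{A,Ω}φ)(x).»), for SYMMETRIC weights and links with `W(z',z)ᵀ = W(z,z')` on their support ([B4]:
`c = η^{-2}/2` on both orientations of the bonds inside `Ω`, `W = U(ηA_b)`, «We assume also that A_{−b} = −A_b for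
an arbitrary bond b»): `(−Δ_W hΦ)(z) = (−Δh)(z)φ(z) − Σ_{z'} 2c(z,z')(h(z') − h(z))(W(z,z')φ(z') − φ(z)) +
h(z)(−Δ_WΦ)(z)` with `(−Δh)(z) = −Σ_{z'}2c(z,z')(h(z') − h(z))` (dictionary: `2c(h(z')−h(z))(Wφ(z')−φ(z)) =
(∂^ηh)(b)(D^η_Aφ)(b)`; the Neumann restriction «b⊂Ω» is carried by the support of `c` — «Special care has to be
taken in considering boundary terms.»). [cite: Balaban1983RegularityDecay, (2.5) p. 576] -/
theorem fld_covLap_mulH (c : X → X → ℝ) (W : X → X → Matrix ι ι ℝ) (hc : ∀ z z', c z z' = c z' z)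
    (hW : ∀ z z', c z z' ≠ 0 → (W z' z)ᵀ = W z z') (h : X → ℝ) (Φ : X × ι → ℝ) (z : X) :
    fld (covLap c W *ᵥ (mulH (ι := ι) h *ᵥ Φ)) z
      = (-(∑ z', 2 * c z z' * (h z' - h z))) • fld Φ z
        - ∑ z', (2 * c z z' * (h z' - h z)) • (W z z' *ᵥ fld Φ z' - fld Φ z)
        + h z • fld (covLap c W *ᵥ Φ) z := by
  rw [fld_covLap_mulH_gen]
  have hker : ∀ z', (h z - h z') • ((c z' z • (W z' z)ᵀ + c z z' • W z z') *ᵥ fld Φ z')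
      = (2 * c z z' * (h z - h z')) • (W z z' *ᵥ fld Φ z') := by
    intro z'
    by_cases h0 : c z z' = 0
    · have h0' : c z' z = 0 := by rw [← hc]; exact h0
      simp [h0, h0']
    · rw [hW z z' h0, ← hc z z', ← add_smul, Matrix.smul_mulVec, smul_smul]
      congr 1
      ring
  simp_rw [hker]
  have hS : ∑ z', (2 * c z z' * (h z' - h z)) • (W z z' *ᵥ fld Φ z' - fld Φ z)
      = -(∑ z', (2 * c z z' * (h z - h z')) • (W z z' *ᵥ fld Φ z'))
        - (∑ z', 2 * c z z' * (h z' - h z)) • fld Φ z := by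
    rw [Finset.sum_smul, ← Finset.sum_neg_distrib, ← Finset.sum_sub_distrib]
    refine Finset.sum_congr rfl fun z' _ => ?_
    rw [smul_sub, show 2 * c z z' * (h z' - h z) = -(2 * c z z' * (h z - h z')) by ring, neg_smul, neg_smul]
  rw [hS, neg_smul]
  abel

end Laplacian

/-! ## §3 (2.8): the commutator with the averaging term `P_k = Q^*Q` -/

section Averaging

variable [Fintype X] [Fintype Y] [Fintype ι] [DecidableEq X] [DecidableEq ι]

/-- the commutator `[h, Q^*Q]` is the block operator with kernel `(h(x) − h(x'))Σ_y q(y,x)q(y,x')T(y,x)ᵀT(y,x')`.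
[cite: Balaban1983RegularityDecay, (2.8) p. 576] -/
theorem projOp_comm (q : Y → X → ℝ) (T : Y → X → Matrix ι ι ℝ) (h : X → ℝ) :
    mulH (ι := ι) h * projOp q T - projOp q T * mulH (ι := ι) h
      = blockOp fun x x' => (h x - h x') • ∑ y, (q y x * q y x') • ((T y x)ᵀ * T y x') := by
  rw [projOp_eq_blockOp, mulH_comm_blockOp]

/-- **(2.8) AS PRINTED** («(P_k(A)hφ)(x) = h(x)(P_k(A)φ)(x) + Σ_{x'∈B^k(y^k(x))} η^d
U(A(Γ^{(k)}_{x,y^k(x),x'}))(∂^ηh)(Γ^{(k)}_{x,y^k(x),x'})φ(x') =: h(x)(P_k(A)φ)(x) + (R_k(A,∂^ηh)φ)(x).»):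
`(Q^*Q hΦ)(x) = h(x)(Q^*QΦ)(x) + Σ_{x'}(h(x') − h(x))·(Σ_y q(y,x)q(y,x')T(y,x)ᵀT(y,x'))φ(x')` (dictionary: the
`y`-sum has the single term `y = y^k(x)`, `T(y,x)ᵀT(y,x') = U(A(Γ^{(k)}_{x,y,x'}))`, and `h(x') − h(x)` is the sum
of `η∂^ηh` along that contour). No hypothesis on `q`, `T`. [cite: Balaban1983RegularityDecay, (2.8) p. 576] -/
theorem fld_projOp_mulH (q : Y → X → ℝ) (T : Y → X → Matrix ι ι ℝ) (h : X → ℝ) (Φ : X × ι → ℝ) (x : X) :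
    fld (projOp q T *ᵥ (mulH (ι := ι) h *ᵥ Φ)) x
      = h x • fld (projOp q T *ᵥ Φ) x
        + ∑ x', (h x' - h x) • ((∑ y, (q y x * q y x') • ((T y x)ᵀ * T y x')) *ᵥ fld Φ x') := by
  have hcomm : projOp q T * mulH (ι := ι) h
      = mulH (ι := ι) h * projOp q T
        - blockOp fun x x' => (h x - h x') • ∑ y, (q y x * q y x') • ((T y x)ᵀ * T y x') := by
    rw [← projOp_comm]; abel
  rw [Matrix.mulVec_mulVec, hcomm, Matrix.sub_mulVec, ← Matrix.mulVec_mulVec]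
  have h1 : fld ((mulH (ι := ι) h *ᵥ (projOp q T *ᵥ Φ))
        - (blockOp fun x x' => (h x - h x') • ∑ y, (q y x * q y x') • ((T y x)ᵀ * T y x')) *ᵥ Φ) x
      = fld (mulH (ι := ι) h *ᵥ (projOp q T *ᵥ Φ)) x
        - fld ((blockOp fun x x' => (h x - h x') • ∑ y, (q y x * q y x') • ((T y x)ᵀ * T y x')) *ᵥ Φ) x := by
    funext i; rfl
  rw [h1, fld_mulH_mulVec, fld_blockOp_mulVec, sub_eq_add_neg, ← Finset.sum_neg_distrib]
  congr 1
  refine Finset.sum_congr rfl fun x' _ => ?_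
  rw [Matrix.smul_mulVec, ← neg_smul, neg_sub]

end Averaging

/-! ## §4 (2.10): `K = [h, H_k(Ã)]` for the full operator (1.6) -/

section OpK

variable [Fintype X] [Fintype Y] [Fintype ι] [DecidableEq X] [DecidableEq ι]

/-- **[B4]'s OPERATOR `K_j` OF (2.10) AS A COMMUTATOR**: `K = mulH h · H − H · mulH h`, `H = −Δ_W + m² + aQ^*Q` the
operator (1.6) of the cube (`B4GaugeCovariance.covOp`), `h = h_j`.
[cite: Balaban1983RegularityDecay, (2.10) p. 576] -/
def opK (c : X → X → ℝ) (m2 a : ℝ) (q : Y → X → ℝ) (W : X → X → Matrix ι ι ℝ) (T : Y → X → Matrix ι ι ℝ)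
    (h : X → ℝ) : Matrix (X × ι) (X × ι) ℝ :=
  mulH (ι := ι) h * covOp c m2 a q W T - covOp c m2 a q W T * mulH (ι := ι) h

/-- the mass term commutes: `K = [h, −Δ_W] + a[h, Q^*Q]`. [cite: Balaban1983RegularityDecay, (2.7)–(2.9) p. 576] -/
theorem opK_eq (c : X → X → ℝ) (m2 a : ℝ) (q : Y → X → ℝ) (W : X → X → Matrix ι ι ℝ)
    (T : Y → X → Matrix ι ι ℝ) (h : X → ℝ) :
    opK c m2 a q W T h
      = (mulH (ι := ι) h * covLap c W - covLap c W * mulH (ι := ι) h)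
        + a • (mulH (ι := ι) h * projOp q T - projOp q T * mulH (ι := ι) h) := by
  unfold opK covOp
  simp only [Matrix.mul_add, Matrix.add_mul, Matrix.mul_smul, Matrix.smul_mul, Matrix.mul_one, Matrix.one_mul,
    smul_sub]
  abel

/-- the block kernel of `K`: `K(z,z') = (h(z) − h(z'))·((−Δ_W)(z,z') + a·Σ_y q(y,z)q(y,z')T(y,z)ᵀT(y,z'))`.
[cite: Balaban1983RegularityDecay, (2.10) p. 576] -/
theorem opK_eq_blockOp (c : X → X → ℝ) (m2 a : ℝ) (q : Y → X → ℝ) (W : X → X → Matrix ι ι ℝ)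
    (T : Y → X → Matrix ι ι ℝ) (h : X → ℝ) :
    opK c m2 a q W T h
      = blockOp fun z z' => (h z - h z') •
          (covLapKer c W z z' + a • ∑ y, (q y z * q y z') • ((T y z)ᵀ * T y z')) := by
  rw [opK_eq, covLap_comm, projOp_comm, ← blockOp_smul, ← blockOp_add]
  congr 1
  funext z z'
  simp only [Pi.add_apply, Pi.smul_apply, smul_add]
  congr 1
  exact smul_comm _ _ _

/-- **(2.10) AS PRINTED** («(K_jφ)(x) = □_j(x)[Σ_{b∈st(x)}(∂^ηh_j)(b)(D^η_{Ã_j}φ)(b) + (Δ^ηh_j)(x)φ(x) −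
Σ_{x'∈B^k(y^k(x))} η^d(∂^ηh_j)(Γ^{(k)}_{x,y^k(x),x'})U(Ã_j(Γ^{(k)}_{x,y^k(x),x'}))φ(x')]»), in the generic weights
(symmetric `c`, `W(z',z)ᵀ = W(z,z')` on the support of `c`):
`(KΦ)(z) = Σ_{z'} 2c(z,z')(h(z') − h(z))(W(z,z')φ(z') − φ(z)) + (Σ_{z'}2c(z,z')(h(z') − h(z)))φ(z)
− a·Σ_{z'}(h(z') − h(z))(Σ_y q(y,z)q(y,z')T(y,z)ᵀT(y,z'))φ(z')`.
[cite: Balaban1983RegularityDecay, (2.10) p. 576] -/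
theorem fld_opK_mulVec (c : X → X → ℝ) (m2 a : ℝ) (q : Y → X → ℝ) (W : X → X → Matrix ι ι ℝ)
    (T : Y → X → Matrix ι ι ℝ) (hc : ∀ z z', c z z' = c z' z) (hW : ∀ z z', c z z' ≠ 0 → (W z' z)ᵀ = W z z')
    (h : X → ℝ) (Φ : X × ι → ℝ) (z : X) :
    fld (opK c m2 a q W T h *ᵥ Φ) z
      = ∑ z', (2 * c z z' * (h z' - h z)) • (W z z' *ᵥ fld Φ z' - fld Φ z)
        + (∑ z', 2 * c z z' * (h z' - h z)) • fld Φ z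
        - a • ∑ z', (h z' - h z) • ((∑ y, (q y z * q y z') • ((T y z)ᵀ * T y z')) *ᵥ fld Φ z') := by
  have hK : opK c m2 a q W T h *ᵥ Φ
      = mulH (ι := ι) h *ᵥ (covOp c m2 a q W T *ᵥ Φ) - covOp c m2 a q W T *ᵥ (mulH (ι := ι) h *ᵥ Φ) := by
    rw [opK, Matrix.sub_mulVec, Matrix.mulVec_mulVec, Matrix.mulVec_mulVec]
  have hfld : fld (opK c m2 a q W T h *ᵥ Φ) z
      = fld (mulH (ι := ι) h *ᵥ (covOp c m2 a q W T *ᵥ Φ)) z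
        - fld (covOp c m2 a q W T *ᵥ (mulH (ι := ι) h *ᵥ Φ)) z := by
    rw [hK]; funext i; rfl
  have hH : ∀ Ψ : X × ι → ℝ, fld (covOp c m2 a q W T *ᵥ Ψ) z
      = fld (covLap c W *ᵥ Ψ) z + m2 • fld Ψ z + a • fld (projOp q T *ᵥ Ψ) z := by
    intro Ψ
    rw [covOp, Matrix.add_mulVec, Matrix.add_mulVec, Matrix.smul_mulVec, Matrix.smul_mulVec,
      Matrix.one_mulVec]
    funext i
    simp [fld]
  rw [hfld, fld_mulH_mulVec, hH Φ, hH (mulH (ι := ι) h *ᵥ Φ), fld_mulH_mulVec, fld_covLap_mulH c W hc hW,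
    fld_projOp_mulH]
  simp only [smul_add, smul_smul]
  rw [mul_comm (h z) m2, mul_comm (h z) a, neg_smul]
  abel

end OpK

/-! ## §5 (2.9) ⇒ (2.11), (2.12): the parametrix identity `H·G₀ = 1 − R` -/

section Parametrix

variable [Fintype X] [Fintype ι] [DecidableEq X] [DecidableEq ι]

/-- **THE PARAMETRIX IDENTITY (2.9)/(2.11)**: with `G₀ = Σ_j h_jG_jh_j` ((2.2)), LOCAL operators `H_j` with
`H_jG_j = 1`, a global `H` satisfying the locality «(−Δ^{η,N}_{A,Ω})h_jG(□_j, Ã_j) = (−Δ^{η,N}_{Ã_j,□_j})h_jG(□_j, Ã)»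
in the form `H·h_j = H_j·h_j`, and the partition of unity `Σ_j h_j² = 1`:
`H·G₀ = 1 − R`, `R = Σ_j K_jG_jh_j`, `K_j = h_jH_j − H_jh_j` («(2.11) R = Σ_j K_j G_k(□_j,Ã_j)h_j.»).
[cite: Balaban1983RegularityDecay, (2.9)–(2.11) p. 576] -/
theorem parametrix_identity {J : Type*} (s : Finset J) (H : Matrix (X × ι) (X × ι) ℝ)
    (Hj G : J → Matrix (X × ι) (X × ι) ℝ) (h : J → X → ℝ)
    (hloc : ∀ j ∈ s, H * mulH (ι := ι) (h j) = Hj j * mulH (ι := ι) (h j)) (hG : ∀ j ∈ s, Hj j * G j = 1)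
    (hsum : ∑ j ∈ s, mulH (ι := ι) (h j) * mulH (ι := ι) (h j) = 1) :
    H * ∑ j ∈ s, mulH (ι := ι) (h j) * G j * mulH (ι := ι) (h j)
      = 1 - ∑ j ∈ s, (mulH (ι := ι) (h j) * Hj j - Hj j * mulH (ι := ι) (h j)) * G j * mulH (ι := ι) (h j) := by
  rw [Finset.mul_sum]
  have hterm : ∀ j ∈ s, H * (mulH (ι := ι) (h j) * G j * mulH (ι := ι) (h j))
      = mulH (ι := ι) (h j) * mulH (ι := ι) (h j)
        - (mulH (ι := ι) (h j) * Hj j - Hj j * mulH (ι := ι) (h j)) * G j * mulH (ι := ι) (h j) := by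
    intro j hj
    rw [← Matrix.mul_assoc, ← Matrix.mul_assoc, hloc j hj, Matrix.sub_mul, Matrix.sub_mul,
      Matrix.mul_assoc (mulH (ι := ι) (h j)) (Hj j) (G j), hG j hj, Matrix.mul_one,
      Matrix.mul_assoc (Hj j) (mulH (ι := ι) (h j)) (G j)]
    abel
  rw [Finset.sum_congr rfl hterm, Finset.sum_sub_distrib, hsum]

/-- **THE ALGEBRA OF (2.12)** («G_k(Ω,A) = G₀(I − R)^{−1}»): under the hypotheses of `parametrix_identity`, if `S`
is a right inverse of `1 − R` and `Gr` is a left inverse of `H`, then `Gr = G₀S`.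
[cite: Balaban1983RegularityDecay, (2.12) p. 577] -/
theorem green_eq_G0_mul_of_inv {J : Type*} (s : Finset J) (H G₀' : Matrix (X × ι) (X × ι) ℝ)
    (Hj G : J → Matrix (X × ι) (X × ι) ℝ) (h : J → X → ℝ)
    (hloc : ∀ j ∈ s, H * mulH (ι := ι) (h j) = Hj j * mulH (ι := ι) (h j)) (hG : ∀ j ∈ s, Hj j * G j = 1)
    (hsum : ∑ j ∈ s, mulH (ι := ι) (h j) * mulH (ι := ι) (h j) = 1)
    (hG₀ : G₀' = ∑ j ∈ s, mulH (ι := ι) (h j) * G j * mulH (ι := ι) (h j))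
    (S Gr : Matrix (X × ι) (X × ι) ℝ)
    (hS : (1 - ∑ j ∈ s, (mulH (ι := ι) (h j) * Hj j - Hj j * mulH (ι := ι) (h j)) * G j * mulH (ι := ι) (h j))
      * S = 1)
    (hGr : Gr * H = 1) : Gr = G₀' * S := by
  have h1 : H * (G₀' * S) = 1 := by
    rw [← Matrix.mul_assoc, hG₀, parametrix_identity s H Hj G h hloc hG hsum, hS]
  calc Gr = Gr * (H * (G₀' * S)) := by rw [h1, Matrix.mul_one]
    _ = (Gr * H) * (G₀' * S) := by rw [Matrix.mul_assoc]
    _ = G₀' * S := by rw [hGr, Matrix.one_mul]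

end Parametrix

end Literature.MathematicalPhysics.QuantumFieldTheory.Balaban1983to89.B4Commutators25to211
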